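import Literature.NumberTheory.EllipticCurves.SkinnerUrban2014.CofinitelyGeneratedSelmerProofs
import HarnessLib

/-!
# Two-sided control with a TORSION (not finite) cokernel defect, Pontryagin-dual side — the algebra atom (m1) of the
# weight-two control map W2 under leaf N2 of K2-M♭ (crux 4 `BSDpOnCellC`, stmt-BirchSwinnertonDyer-19034; helper, closes nothing)

Ideator bsd-idea-12 g36 (W-71/W-79: no route births, nothing registered). Theorems only (no definition, no named fact, no
`sorry`, no instance, no notation). BSD is proved for no curve; no crux / registered stub / summit statement is proved here.

The landed finite-defect lemmas — `ControlDualFinite.exists_quotSMulTop_linearMap_of_finite_index` (injective `θ`,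
range of FINITE index in `N₂[r]`) and `TelescopeK2ControlAlgebra.exists_quotSMulTop_linearMap_twoSided` (p737674: finite
kernel AND finite index) — do not cover the weight-two control map of the branch on Cell C: in the split-multiplicative
exceptional case the `𝔭̄`-local control defect is an INFINITE cotorsion module, so `range θ` has infinite index in
`N₂[r]`, but `N₂[r]/range θ` is still killed by ONE element `s` prime to `r` (pricing memo `Cruxes/BSDpOnCellC/W-PRICING-n2.md`
§0(b), (m1)). This file proves the corresponding dual statement, which is exactly the shape of sub-leaf W2
(`K2Weight2.stub_weightTwoControlMap` of the UNREGISTERED workfile `Cruxes/BSDpOnCellC/Lines/telescopeK2weight2.lean`):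

* `exists_quotSMulTop_linearMap_torsionDefect` — for an `S`-linear `θ : N₁ → N₂` with `r • θ = 0`, FINITE kernel, and
  `s • N₂[r] ⊆ range θ`: there is an `S`-linear `f : N₂^∨/r·N₂^∨ → N₁^∨` with `f [χ] = χ ∘ θ`, whose KERNEL IS KILLED BY `s`
  and whose COKERNEL IS FINITE (it embeds into `(ker θ)^∨`).
* `exists_quotSMulTop_linearMap_torsionDefect_of_not_dvd` — the same with the kernel clause in W2's elementwise form
  `∀ m ∈ ker f, ∃ t, ¬ r ∣ t ∧ t • m = 0`, given `¬ r ∣ s`.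

Proof: `f` is the descent of Mathlib's `CharacterModule.dual θ` to `N₂^∨/r·N₂^∨` (`r • χ` dies on `range θ ⊆ N₂[r]`-images…
precisely `(r • χ)(θ n) = χ(r • θ n) = 0`); if `χ ∘ θ = 0` then `s • χ` kills `N₂[r]` (as `s • N₂[r] ⊆ range θ`), so `s • χ`
is an `r`-multiple (`SkinnerUrban2014.exists_smul_eq_of_forall_apply_eq_zero`: `ℚ/ℤ` is divisible) and `s • [χ] = 0`; a
character `ψ` of `N₁` vanishing on `ker θ` factors through `N₁/ker θ ≅ range θ ↪ N₂` and extends to `N₂`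
(`CharacterModule.dual_surjective_of_injective`), so `range f ⊇ ker (N₁^∨ → (ker θ)^∨)` and `N₁^∨/range f ↪ (ker θ)^∨`,
finite (`SkinnerUrban2014.finite_characterModule`). [folklore]

## References
[cite: JetchevSkinnerWan2017, §3.4, Lemma 3.4.1 (arXiv:1512.06894 p. 14)] [cite: Ochiai2006, Prop. 5.1 (Compositio 142, p. 1177:
"the assertions on Coker(res_J) hold without Condition (Ir)")] [cite: Castella2018Erratum, Lemma 2.1] [cite: Washington1997, Lemma 13.16]
-/

noncomputable section

-- D-0017: single-problem summit, the namespace repeats the problem name by design.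
set_option linter.dupNamespace false
set_option autoImplicit false

namespace Summit.BirchSwinnertonDyer.BirchSwinnertonDyer.Theorems.TelescopeK2ControlTorsionDefect

open Literature.NumberTheory.EllipticCurves
open scoped Pointwise

variable {S : Type*} [CommRing S] (r s : S)
  {N₁ N₂ : Type*} [AddCommGroup N₁] [Module S N₁] [AddCommGroup N₂] [Module S N₂]
  (θ : N₁ →ₗ[S] N₂)

/-- **Pontryagin dual of a control map with FINITE kernel and `s`-TORSION cokernel defect.** For an `S`-linear
`θ : N₁ → N₂` with `r • θ = 0`, `ker θ` finite and `s • N₂[r] ⊆ range θ`, there is an `S`-linear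
`f : QuotSMulTop r (CharacterModule N₂) → CharacterModule N₁` with `f [χ] = χ ∘ θ`, KERNEL KILLED BY `s`, and FINITE
COKERNEL. (The dual form of weight-two control with two-sided defect: `X₂/(C X)X₂ → Sel(M₂[C X])^∨`.)
[cite: JetchevSkinnerWan2017, §3.4, Lemma 3.4.1 (arXiv:1512.06894 p. 14)] [cite: Ochiai2006, Prop. 5.1 (p. 1177)] [folklore] -/
theorem exists_quotSMulTop_linearMap_torsionDefect (hθr : ∀ n : N₁, r • θ n = 0)
    (hker : Finite (LinearMap.ker θ))
    (hs : ∀ y : N₂, r • y = 0 → s • y ∈ LinearMap.range θ) :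
    ∃ f : QuotSMulTop r (CharacterModule N₂) →ₗ[S] CharacterModule N₁,
      (∀ χ : CharacterModule N₂, f (Submodule.Quotient.mk χ) = CharacterModule.dual θ χ) ∧
      (∀ m ∈ LinearMap.ker f, s • m = 0) ∧
      Finite (CharacterModule N₁ ⧸ LinearMap.range f) := by
  classical
  -- the dual `χ ↦ χ ∘ θ` kills `r • N₂^∨`
  have hle : r • (⊤ : Submodule S (CharacterModule N₂)) ≤ LinearMap.ker (CharacterModule.dual θ) := by
    intro χ hχ
    rw [Submodule.mem_smul_pointwise_iff_exists] at hχ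
    obtain ⟨ψ, -, rfl⟩ := hχ
    rw [LinearMap.mem_ker]
    ext n
    change (r • ψ) (θ n) = 0
    rw [CharacterModule.smul_apply, hθr, map_zero]
  let f : QuotSMulTop r (CharacterModule N₂) →ₗ[S] CharacterModule N₁ :=
    (r • (⊤ : Submodule S (CharacterModule N₂))).liftQ (CharacterModule.dual θ) hle
  have hf : ∀ χ : CharacterModule N₂, f (Submodule.Quotient.mk χ) = CharacterModule.dual θ χ :=
    fun _ ↦ rfl
  refine ⟨f, hf, ?_, ?_⟩
  · -- kernel killed by `s`: `χ ∘ θ = 0 ⇒ s • χ` kills `N₂[r]` `⇒ s • χ ∈ r • N₂^∨`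
    intro m hm
    induction m using Submodule.Quotient.induction_on with
    | H χ =>
      rw [LinearMap.mem_ker, hf] at hm
      have hkill : ∀ y : N₂, r • y = 0 → (s • χ) y = 0 := by
        intro y hy
        obtain ⟨n, hn⟩ := hs y hy
        rw [CharacterModule.smul_apply, ← hn]
        exact DFunLike.congr_fun hm n
      obtain ⟨ψ, hψ⟩ := SkinnerUrban2014.exists_smul_eq_of_forall_apply_eq_zero r (s • χ) hkill
      change Submodule.Quotient.mk (s • χ) = (0 : QuotSMulTop r (CharacterModule N₂))
      rw [Submodule.Quotient.mk_eq_zero]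
      exact (Submodule.mem_smul_pointwise_iff_exists _ _ _).2 ⟨ψ, Submodule.mem_top, hψ⟩
  · -- finite cokernel: `N₁^∨ / range f ↪ (ker θ)^∨`
    haveI : Finite (CharacterModule (LinearMap.ker θ)) :=
      SkinnerUrban2014.finite_characterModule (LinearMap.ker θ)
    -- restriction to `ker θ`
    let res : CharacterModule N₁ →ₗ[S] CharacterModule (LinearMap.ker θ) :=
      CharacterModule.dual (LinearMap.ker θ).subtype
    -- `range f ≤ ker res`
    have hrange : LinearMap.range f ≤ LinearMap.ker res := by
      rintro ψ ⟨m, rfl⟩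
      induction m using Submodule.Quotient.induction_on with
      | H χ =>
        rw [LinearMap.mem_ker, hf]
        ext ⟨n, hn⟩
        change χ (θ n) = 0
        rw [LinearMap.mem_ker] at hn
        rw [hn, map_zero]
    -- `ker res ≤ range f`: a character vanishing on `ker θ` factors through `N₁/ker θ ≅ range θ ↪ N₂` and extends
    have hker_le : LinearMap.ker res ≤ LinearMap.range f := by
      intro ψ hψ
      rw [LinearMap.mem_ker] at hψ
      have hψ0 : ∀ n ∈ LinearMap.ker θ, ψ n = 0 := fun n hn ↦ by
        have e := DFunLike.congr_fun hψ ⟨n, hn⟩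
        exact e
      -- descend `ψ` to `N₁ ⧸ ker θ`
      let ψbar : CharacterModule (N₁ ⧸ LinearMap.ker θ) :=
        QuotientAddGroup.lift (LinearMap.ker θ).toAddSubgroup ψ fun n hn ↦ hψ0 n hn
      have hψbar : ∀ n : N₁, ψbar (Submodule.Quotient.mk n) = ψ n := fun _ ↦ rfl
      -- the injection `N₁ ⧸ ker θ ↪ N₂`
      let θbar : (N₁ ⧸ LinearMap.ker θ) →ₗ[S] N₂ :=
        (LinearMap.range θ).subtype ∘ₗ θ.quotKerEquivRange.toLinearMap
      have hθbar : ∀ n : N₁, θbar (Submodule.Quotient.mk n) = θ n := fun n ↦ by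
        change ((θ.quotKerEquivRange (Submodule.Quotient.mk n) : LinearMap.range θ) : N₂) = θ n
        rw [LinearMap.quotKerEquivRange_apply_mk]
      have hinj : Function.Injective θbar :=
        (Submodule.injective_subtype _).comp θ.quotKerEquivRange.injective
      obtain ⟨χ, hχ⟩ := CharacterModule.dual_surjective_of_injective θbar hinj ψbar
      refine ⟨Submodule.Quotient.mk χ, ?_⟩
      rw [hf]
      ext n
      change χ (θ n) = ψ n
      rw [← hθbar, ← hψbar n]
      exact DFunLike.congr_fun hχ (Submodule.Quotient.mk n)
    -- the induced injection of the cokernel into `(ker θ)^∨`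
    let Φ : (CharacterModule N₁ ⧸ LinearMap.range f) →ₗ[S] CharacterModule (LinearMap.ker θ) :=
      (LinearMap.range f).liftQ res hrange
    refine Finite.of_injective Φ ?_
    rw [← LinearMap.ker_eq_bot, Submodule.eq_bot_iff]
    intro q hq
    induction q using Submodule.Quotient.induction_on with
    | H ψ =>
      rw [LinearMap.mem_ker, Submodule.liftQ_apply] at hq
      exact (Submodule.Quotient.mk_eq_zero _).2 (hker_le hq)

/-- **W2's elementwise kernel clause.** Under the hypotheses of `exists_quotSMulTop_linearMap_torsionDefect` with `s` prime to
`r` (`¬ r ∣ s`), the control map `f` has cokernel FINITE and kernel killed ELEMENTWISE by elements prime to `r` — the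
exact shape of sub-leaf W2 (`∀ m ∈ ker α, ∃ t, ¬ (r ∣ t) ∧ t • m = 0`). [cite: Ochiai2006, Prop. 5.1 (p. 1177)] [folklore] -/
theorem exists_quotSMulTop_linearMap_torsionDefect_of_not_dvd (hθr : ∀ n : N₁, r • θ n = 0)
    (hker : Finite (LinearMap.ker θ))
    (hs : ∀ y : N₂, r • y = 0 → s • y ∈ LinearMap.range θ) (hrs : ¬ r ∣ s) :
    ∃ f : QuotSMulTop r (CharacterModule N₂) →ₗ[S] CharacterModule N₁,
      (∀ χ : CharacterModule N₂, f (Submodule.Quotient.mk χ) = CharacterModule.dual θ χ) ∧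
      (∀ m ∈ LinearMap.ker f, ∃ t : S, ¬ (r ∣ t) ∧ t • m = 0) ∧
      Finite (CharacterModule N₁ ⧸ LinearMap.range f) := by
  obtain ⟨f, hf, hkerf, hcok⟩ := exists_quotSMulTop_linearMap_torsionDefect r s θ hθr hker hs
  exact ⟨f, hf, fun m hm ↦ ⟨s, hrs, hkerf m hm⟩, hcok⟩

end Summit.BirchSwinnertonDyer.BirchSwinnertonDyer.Theorems.TelescopeK2ControlTorsionDefect

end
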